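import Literature.Probability.Percolation.GladkovZiminKernel
import Mathlib.Algebra.Order.BigOperators.Group.Finset
import Mathlib.Tactic.Linarith
import Mathlib.Tactic.Ring
import Mathlib.Tactic.FieldSimp
import HarnessLib
import HarnessLib.Audit

/-!
# `NoHeavyLowerTail` (crux stmt-CriticalPhenomena-4575), Sahi programme P4 (monotone coupling): masses of predicates on the
# weighted cube — preliminaries for the constructive monotone transport (`…HarrisTransport`)

Support file (cell `prim-l12`, seat P4; `--supports stmt-CriticalPhenomena-4575`).  `pmass D p X = Σ_{S ⊆ D, X S} wtW D p S`
(an `ED`-expectation of an indicator, `Literature.Probability.Percolation.DecisionTree.ED`), its one-coordinate decomposition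
(`pmass_insert`), nonnegativity, monotonicity, and "mass zero ⇒ every weight zero".  No named facts, no sorries. [this work]
-/

noncomputable section

open scoped Classical

namespace Summit.CriticalPhenomena.PercolationContinuityZ3.Theorems.C3Transport

open Finset Literature.Probability.Percolation.DecisionTree

variable {ι : Type*} [DecidableEq ι]

/-! ### Masses of predicates under the weighted cube -/

/-- The mass of a predicate on configurations under the weighted cube on `D`: `Σ_{S ⊆ D, X S} wtW D p S`
(an `ED`-expectation of an indicator). [folklore] -/
def pmass (D : Finset ι) (p : ι → ℝ) (X : Finset ι → Prop) : ℝ :=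
  ED D p fun S => if X S then 1 else 0

/-- Unfolding `pmass` as a sum of weights. [folklore] -/
theorem pmass_eq_sum (D : Finset ι) (p : ι → ℝ) (X : Finset ι → Prop) :
    pmass D p X = ∑ S ∈ D.powerset, if X S then wtW D p S else 0 := by
  unfold pmass ED
  exact Finset.sum_congr rfl fun S _ => by by_cases h : X S <;> simp [h]

/-- One-coordinate decomposition of a mass: `μ_{insert e D}(X) = (1 − p_e)·μ_D(X) + p_e·μ_D(X ∘ insert e)`. [folklore] -/
theorem pmass_insert {D : Finset ι} {e : ι} (p : ι → ℝ) (he : e ∉ D) (X : Finset ι → Prop) :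
    pmass (insert e D) p X = (1 - p e) * pmass D p X + p e * pmass D p (fun S => X (insert e S)) := by
  unfold pmass
  rw [ED_insert p he]

/-- Masses are nonnegative for `p ∈ [0,1]`. [folklore] -/
theorem pmass_nonneg (D : Finset ι) {p : ι → ℝ} (hp0 : ∀ i, 0 ≤ p i) (hp1 : ∀ i, p i ≤ 1) (X : Finset ι → Prop) :
    0 ≤ pmass D p X := by
  rw [pmass_eq_sum]
  exact Finset.sum_nonneg fun S _ => by
    split_ifs
    · exact wtW_nonneg D hp0 hp1 S
    · exact le_rfl

/-- Masses are monotone under implication of predicates. [folklore] -/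
theorem pmass_mono (D : Finset ι) {p : ι → ℝ} (hp0 : ∀ i, 0 ≤ p i) (hp1 : ∀ i, p i ≤ 1) {X Y : Finset ι → Prop}
    (h : ∀ S, S ⊆ D → X S → Y S) : pmass D p X ≤ pmass D p Y := by
  rw [pmass_eq_sum, pmass_eq_sum]
  refine Finset.sum_le_sum fun S hS => ?_
  have hSD : S ⊆ D := Finset.mem_powerset.1 hS
  by_cases hX : X S
  · rw [if_pos hX, if_pos (h S hSD hX)]
  · rw [if_neg hX]
    split_ifs
    · exact wtW_nonneg D hp0 hp1 S
    · exact le_rfl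

/-- If a predicate has mass `0`, every configuration satisfying it has weight `0`. [folklore] -/
theorem wtW_eq_zero_of_pmass_eq_zero (D : Finset ι) {p : ι → ℝ} (hp0 : ∀ i, 0 ≤ p i) (hp1 : ∀ i, p i ≤ 1)
    {X : Finset ι → Prop} (h0 : pmass D p X = 0) {S : Finset ι} (hS : S ⊆ D) (hX : X S) : wtW D p S = 0 := by
  rw [pmass_eq_sum] at h0
  have hnn : ∀ T ∈ D.powerset, 0 ≤ (if X T then wtW D p T else 0) := fun T _ => by
    split_ifs
    · exact wtW_nonneg D hp0 hp1 T
    · exact le_rfl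
  have := (Finset.sum_eq_zero_iff_of_nonneg hnn).1 h0 S (Finset.mem_powerset.2 hS)
  rwa [if_pos hX] at this

end Summit.CriticalPhenomena.PercolationContinuityZ3.Theorems.C3Transport
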